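import Summits.QuantumFields.YangMills.Theorems.BalabanUVNodesPortS1ClassNestReduction
import Summits.QuantumFields.YangMills.Theorems.BalabanUVNodesPortS1FEStepPieces

/-!
# NODE O port PT-A — ★★★ director-ym №650 docket (A): `stub_regClassNestsUc` IS A THEOREM MODULO ONE [15]-REGULARITY LETTER.  The letter `RegThm1RowsAtRecord F` (antecedent form, the ⁸ prefix
# BYTE-IDENTICAL to ✓`RegClassNestsUc` ∕ ✓`RegClassP5`): at every point of the ε₀-class, (1.12)'s LOCAL GAUGES `U^u = exp iξA`, `|A|, |∇^ξ A| < c_B α₀` on the record's cubes AND (1.14)'s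
# CURRENT BOUND `|J(U_{k+1}(W_B))| < α₀` on the bonds of every domain — [15] Thm 1 (9) + the current clause of 𝔘_k (2) — and the closer `regClassNestsUc_of_regThm1Rows` by ✓`cutsInUc_of_inRegClass_of_localGauges`

Cell `ym-nodeO-ideate`, porter seat PT-A-1 (gen 11∕12 = «the [15] desk»); `--kind definition --supports stmt-QuantumFields-27930 --as helper`; count-neutral.
[I] = [Balaban1987RG1]; [15] = [Balaban1985Variational].

LOCATED (read-only, before typing).  [15] Thm 1 IS typed in the tree — `Literature.….B11.Thm1Printed` ∕ `B11.Regularity` carry (9)–(10) p.279 verbatim («for an arbitrary cube □ … there exists a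
gauge transformation u … U^{u⁻¹} = e^{iηA}, |A| < B₃Mε₁(L^jη)^{−1}, |∇^η A| < B₃Mε₁(L^jη)^{−2} …») — but over the ABSTRACT carrier `B11.VarProblem` (fields `Gauged`, `normA`, `normGradA`, `InU`
uninterpreted); the record's objects (`recordBgUnits F θ k K B` = `U_{k+1}(W_B)` in the rooted gauge, `recordCurrent` = its (1.8) current, the `Sect2.frameI` cubes of `R_z`) have NO interpretation
map into that carrier, and the tree's `bgReg` omits the current clause of 𝔘_k (2) («|(D*_U ∂U)(b)| < ε₀η²(L^jη)^{−3}», D-defB-1).  So (1.12)∕(1.14) at the record cannot be cited BY NAME: the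
carrier interpretation at the record IS the content of the one letter below — the P0-ℝ ∕ node00-def-Y supply ([15] Thm 1 (9) for `U_{k+1}(W_B)`, `W_B = W(V_k exp(iC*B))` regular by the class's
plaquette bound; the current row from 𝔘_k (2)'s second clause with `B₃ε₁ ≤ α₀`, [I] p.263 L9–13 «J = D^{η*}ξ^{−2}π Im ∂U satisfies the bound |J| < α₀′ … in particular the minimal configurations U_j»).

WHY.  ✓`cutsInUc_of_inRegClass_of_localGauges` (✓`…PortS1ClassNestReduction` §2) proved: at a class point with `0 < ε₀ ≤ α₀`, `0 < α₁`, the two displayed rows ⟹ `CutsInUc … α₀ α₁ … B`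
((1.11) from the class's own plaquette bound, (1.13) with `A′ := 0`, (iv) vacuous at the record — bookkeeping, done there).  Hence ✓`RegClassNestsUc F` (★★ DEF-1's hoist ✓`…PortS1FEStepPieces`
:123, the nesting letter of record shared by the LZ half ✓`lzHalfReg_of_P0C_of_classP2_of_regClass` and the FE split) follows from the rows letter with `εn ↦ min εn α₀` — this file.
* §0 `RegThm1RowsAtRecord` (def, antecedent form: ⁸ prefix + `∀ ε₂₉ α₀ α₁ > 0, ∃ εn > 0, ∀ ε₀ ∈ (0, εn], ∀ k n B, InRegClass … ε₀ … B → ROWS(B)`).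
* §1 ★★★ `regClassNestsUc_of_regThm1RowsAtRecord` (one family) · `regClassNestsUc_of_regThm1Rows` (all families) — `stub_regClassNestsUc` modulo the ONE letter.
* §2 ★ `regThm1Rows_body_zero` — (◆ C34 (t4)-style) THE ROWS HOLD AT THE BASE POINT `B = 0` (`u := 1`, `A := 0`, `J(1) = 0`): the letter is not vacuous-by-contradiction at its germ's centre.

HONEST FRAMING.  ONE letter asserted for nothing (inhabited NOWHERE; its supplier = the P0-ℝ∕def-Y [15] desk: Thm 1 (9) AT THE RECORD + 𝔘_k (2)'s current clause) + an `obtain` chain over the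
tree's own theorem; with it v3.8's `stub_regClassNestsUc` is a theorem MODULO `RegThm1RowsAtRecord` (registry untouched by this file: the stub stays registered until the letter is discharged or
the ★★★ word re-keys it); nothing of Bałaban's RG estimates asserted, ported or discharged; ⟨27930⟩ OPEN 1∕7 (v3.8) · no claim; NODE O 0∕1; COUNT 8∕28 · K 1∕4 UNMOVED; finite `𝕋⁴_{L^K}` at
fixed ε — NOT continuum ∕ OS; **the Yang–Mills mass gap (Clay) is NOT proved by any of this.**  No `sorry`, no `instance`; standard axioms.
-/

noncomputable section

open scoped BigOperators Matrix.Norms.L2Operator Topology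

namespace Summit.QuantumFields.YangMills.Theorems.BalabanUVNodesPortS1

open Summit.QuantumFields.YangMills.Theorems.K0RecordFormatNames
open Literature.MathematicalPhysics.QuantumFieldTheory.Balaban1983to89
open Literature.MathematicalPhysics.QuantumFieldTheory.Balaban1983to89.Node00
open Literature.MathematicalPhysics.QuantumFieldTheory.Balaban1983to89.T4Continuum (T4Family)

/-! ## §0  The [15]-regularity rows letter (antecedent form) -/

/-- ★★★ **`RegThm1RowsAtRecord F` — [15] Thm 1's REGULARITY ROWS AT THE RECORD, ON THE ε₀-CLASS (antecedent form)**: under the ⁸ antecedent of `PortRecordRepresentationS1` (prefix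
byte-identical to ✓`RegClassNestsUc`), for every `(ε₂₉, α₀, α₁) > 0` a class radius `εn > 0` such that at every `B` with `InRegClass F Mc k ε₀ a₀ ε₂₉ n B`, `0 < ε₀ ≤ εn`:
(1.12) on every cube `C` of record (`Sect2.frameI (R_z) Mc (k+1) (domSites X)`) of every domain `X` there are a `G`-valued `u` and `A` with `U_{k+1}(W_B)^u = exp iξA` on `C`'s bonds,
`|A(b)| < c_B α₀` on `C`'s bonds and `|∇^ξ A| < c_B α₀` on `C`'s derivative pairs (`ξ = η_{k+1}`, `c_B` of `StepConsts.ofParams … (recordCB F) (k+1)`); AND (1.14) `|J(U_{k+1}(W_B))(b)| < α₀`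
on the bonds of every `X`.  Print: [15] Thm 1 (9) p.279 for the minimiser `U_{k+1}(W_B)` (typed abstractly as `B11.Thm1Printed`∕`B11.Regularity`; HERE at the record's objects) and the
current clause of 𝔘_k (2) p.278 with `B₃ε₁ ≤ α₀` ([I] p.263 L9–13).  INTENDED SUPPLIER: the P0-ℝ ∕ node00-def-Y [15] desk (same wall as `stub_P0C`).  A `Prop`; asserted for nothing;
consumed by ★★★`regClassNestsUc_of_regThm1Rows`. [cite: Balaban1985Variational, Thm 1 (9) p.279, (2) p.278, (19)–(20) p.281; Balaban1987RG1, (1.12) p.262, (1.14) p.262, p.263 L5–13, (1.8) p.261] -/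
def RegThm1RowsAtRecord (F : T4Family) : Prop :=
  ∃ Mth : ℕ, ∀ Mc : ℕ, Mth ≤ Mc → ∀ (j c c₀ c₁ : ℕ) (B₃ B₃' a₀ a₁ : ℝ), Summit.QuantumFields.YangMills.Theorems.K0RecordFormatNames.McGuard F Mc → c ≤ F.L ^ j → c₀ ≤ j + 1 → c₁ ≤ j → 2 * (F.L : ℝ) ^ 2 ≤ B₃ → 0 < B₃' → 0 < a₀ → 0 < a₁ → Literature.MathematicalPhysics.QuantumFieldTheory.Balaban1983to89.Node00.VariationalThm1RegSepCoP7MGB F 2 (fun ν M g K k _s => c ≤ ν.M₁ ∧ k + c₀ ≤ F.m + K ∧ F.L ^ c₁ ∣ M ∧ ∀ i, 1 ≤ i → i ≤ k → Literature.MathematicalPhysics.QuantumFieldTheory.Balaban1983to89.Node00.dCubeSide (F.P K).L M (Literature.MathematicalPhysics.QuantumFieldTheory.Balaban1983to89.Node00.RkOfRecord (F.P K).L ν.r (g i)) i ∣ (F.P K).sitesPerDir 0) (Literature.MathematicalPhysics.QuantumFieldTheory.Balaban1983to89.Node00.lamDatum F) (Literature.MathematicalPhysics.QuantumFieldTheory.Balaban1983to89.Node00.dataSmall7LamTopOf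 F 2) B₃ a₀ a₁ → Literature.MathematicalPhysics.QuantumFieldTheory.Balaban1983to89.Node00.Gauge9RegSepTopStepGB F 2 (fun ν K Ω => Literature.MathematicalPhysics.QuantumFieldTheory.Balaban1983to89.Node00.suppDomOfRecord F ν K Ω) (F.L ^ j) (fun ν M g K k _s => c ≤ ν.M₁ ∧ k + c₀ ≤ F.m + K ∧ F.L ^ c₁ ∣ M ∧ ∀ i, 1 ≤ i → i ≤ k → Literature.MathematicalPhysics.QuantumFieldTheory.Balaban1983to89.Node00.dCubeSide (F.P K).L M (Literature.MathematicalPhysics.QuantumFieldTheory.Balaban1983to89.Node00.RkOfRecord (F.P K).L ν.r (g i)) i ∣ (F.P K).sitesPerDir 0) (Literature.MathematicalPhysics.QuantumFieldTheory.Balaban1983to89.Node00.lamDatum F) (Literature.MathematicalPhysics.QuantumFieldTheory.Balaban1983to89.Node00.dataSmall7LamTopOf F 2) B₃ B₃' a₀ a₁ → (∀ ε₁ : ℝ, 0 < ε₁ → ε₁ ≤ a₁ → B₃ * ε₁ ≤ a₀ → ∀ (k n : ℕ) (V : Literature.MathematicalPhysics.QuantumFieldTheory.Balaban1983to89.GaugeField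 (F.P (Summit.QuantumFields.YangMills.Theorems.K0RecordFormatNames.recordK₀ F Mc k + n)) (k + 1) (Literature.MathematicalPhysics.QuantumFieldTheory.Balaban1983to89.Node00.SU 2)), Literature.MathematicalPhysics.QuantumFieldTheory.Balaban1983to89.PlaqSmall ε₁ V → Literature.MathematicalPhysics.QuantumFieldTheory.Balaban1983to89.Node00.UkExists F 2 (Summit.QuantumFields.YangMills.Theorems.K0RecordFormatNames.recordK₀ F Mc k + n) (k + 1) a₀ V ∧ Literature.MathematicalPhysics.QuantumFieldTheory.Balaban1983to89.Node00.UniqueUkOrbit F 2 (Summit.QuantumFields.YangMills.Theorems.K0RecordFormatNames.recordK₀ F Mc k + n) (k + 1) a₀ V) → (∀ (k n : ℕ) (ε₂₉ : ℝ), 0 < ε₂₉ → letI θ := Summit.QuantumFields.YangMills.Theorems.K0RecordFormatNames.thetaFill F a₀ ε₂₉; letI := θ.instVβ₁; letI := θ.instVβ₂; letI := θ.instιβ; AnalyticAt ℝ (fun B : Summit.QuantumFields.YangMills.Theorems.K0RecordFormatNames.recordW F a₀ ε₂₉ k (Summit.QuantumFields.YangMills.Theorems.K0RecordFormatNames.recordK₀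 F Mc k + n) => fun (b : Literature.MathematicalPhysics.QuantumFieldTheory.Balaban1983to89.PBond (F.P (Summit.QuantumFields.YangMills.Theorems.K0RecordFormatNames.recordK₀ F Mc k + n)) 0) (i i' : Fin 2) => ((Summit.QuantumFields.YangMills.Theorems.K0RecordFormatNames.recordBgField F θ k (Summit.QuantumFields.YangMills.Theorems.K0RecordFormatNames.recordK₀ F Mc k + n) B b : Literature.MathematicalPhysics.QuantumFieldTheory.Balaban1983to89.Node00.SU 2) : Matrix (Fin 2) (Fin 2) ℂ) i i') 0) → (∃ C₉' δ₉ : ℝ, 0 ≤ C₉' ∧ 0 < δ₉ ∧ ∀ (k n : ℕ) (ε₂₉ : ℝ), 0 < ε₂₉ → letI θ := Summit.QuantumFields.YangMills.Theorems.K0RecordFormatNames.thetaFill F a₀ ε₂₉; letI := θ.instVβ₁; letI := θ.instVβ₂; letI := θ.instιβ; ∀ (a : θ.ιβ) (μ : Fin (F.P (Summit.QuantumFields.YangMills.Theorems.K0RecordFormatNames.recordK₀ F Mc k + n)).d) (y : Literature.MathematicalPhysics.QuantumFieldTheory.Balaban1983to89.Site (F.P (Summit.QuantumFields.YangMills.Theorems.K0RecordFormatNames.recordK₀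 F Mc k + n)) (k + 1)), letI D := fderiv ℝ (fun B : Summit.QuantumFields.YangMills.Theorems.K0RecordFormatNames.recordW F a₀ ε₂₉ k (Summit.QuantumFields.YangMills.Theorems.K0RecordFormatNames.recordK₀ F Mc k + n) => fun (b : Literature.MathematicalPhysics.QuantumFieldTheory.Balaban1983to89.PBond (F.P (Summit.QuantumFields.YangMills.Theorems.K0RecordFormatNames.recordK₀ F Mc k + n)) 0) (i i' : Fin 2) => ((Summit.QuantumFields.YangMills.Theorems.K0RecordFormatNames.recordBgField F θ k (Summit.QuantumFields.YangMills.Theorems.K0RecordFormatNames.recordK₀ F Mc k + n) B b : Literature.MathematicalPhysics.QuantumFieldTheory.Balaban1983to89.Node00.SU 2) : Matrix (Fin 2) (Fin 2) ℂ) i i') 0 (Pi.single μ (Pi.single y (θ.bV a))); ∃ (Hr : Literature.MathematicalPhysics.QuantumFieldTheory.Balaban1983to89.PBond (F.P (Summit.QuantumFields.YangMills.Theorems.K0RecordFormatNames.recordK₀ F Mc k + n)) 0 → Fin 2 → Fin 2 → ℂ) (φ : Literature.MathematicalPhysics.QuantumFieldTheory.Balaban1983to89.Site (F.P (Summit.QuantumFields.YangMills.Theorems.K0RecordFormatNames.recordK₀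 F Mc k + n)) 0 → Fin 2 → Fin 2 → ℂ), (∀ b : Literature.MathematicalPhysics.QuantumFieldTheory.Balaban1983to89.PBond (F.P (Summit.QuantumFields.YangMills.Theorems.K0RecordFormatNames.recordK₀ F Mc k + n)) 0, D b = Hr b + (φ b.src - φ (b.src.shift b.dir))) ∧ (∃ μc : Literature.MathematicalPhysics.QuantumFieldTheory.Balaban1983to89.Site (F.P (Summit.QuantumFields.YangMills.Theorems.K0RecordFormatNames.recordK₀ F Mc k + n)) (k + 1) → Fin 2 → Fin 2 → ℂ, ∀ x : Literature.MathematicalPhysics.QuantumFieldTheory.Balaban1983to89.Site (F.P (Summit.QuantumFields.YangMills.Theorems.K0RecordFormatNames.recordK₀ F Mc k + n)) 0, letI dv := (fun x' : Literature.MathematicalPhysics.QuantumFieldTheory.Balaban1983to89.Site (F.P (Summit.QuantumFields.YangMills.Theorems.K0RecordFormatNames.recordK₀ F Mc k + n)) 0 => ∑ ν : Fin (F.P (Summit.QuantumFields.YangMills.Theorems.K0RecordFormatNames.recordK₀ F Mc k + n)).d, (Hr ⟨x', ν⟩ - Hr ⟨x'.unshift ν, ν⟩)); ∑ ν : Fin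 (F.P (Summit.QuantumFields.YangMills.Theorems.K0RecordFormatNames.recordK₀ F Mc k + n)).d, (dv (x.shift ν) - (2 : ℂ) • dv x + dv (x.unshift ν)) = μc (Summit.QuantumFields.YangMills.Theorems.K0RecordFormatNames.coarsenTo (k + 1) x)) ∧ ∀ b : Literature.MathematicalPhysics.QuantumFieldTheory.Balaban1983to89.PBond (F.P (Summit.QuantumFields.YangMills.Theorems.K0RecordFormatNames.recordK₀ F Mc k + n)) 0, ‖Hr b‖ ≤ C₉' * (F.P (Summit.QuantumFields.YangMills.Theorems.K0RecordFormatNames.recordK₀ F Mc k + n)).eta (k + 1) * Real.exp (-(δ₉ * (Literature.MathematicalPhysics.QuantumFieldTheory.Balaban1983to89.Site.tdist (Summit.QuantumFields.YangMills.Theorems.K0RecordFormatNames.coarsenTo (k + 1) b.src) y : ℝ))) ∧ (∀ ν : Fin (F.P (Summit.QuantumFields.YangMills.Theorems.K0RecordFormatNames.recordK₀ F Mc k + n)).d, ‖Hr (⟨b.src.shift ν, b.dir⟩ : Literature.MathematicalPhysics.QuantumFieldTheory.Balaban1983to89.PBond (F.P (Summit.QuantumFields.YangMills.Theorems.K0RecordFormatNames.recordK₀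 F Mc k + n)) 0) - Hr b‖ ≤ C₉' * (F.P (Summit.QuantumFields.YangMills.Theorems.K0RecordFormatNames.recordK₀ F Mc k + n)).eta (k + 1) ^ 2 * Real.exp (-(δ₉ * (Literature.MathematicalPhysics.QuantumFieldTheory.Balaban1983to89.Site.tdist (Summit.QuantumFields.YangMills.Theorems.K0RecordFormatNames.coarsenTo (k + 1) b.src) y : ℝ)))) ∧ ‖∑ ν : Fin (F.P (Summit.QuantumFields.YangMills.Theorems.K0RecordFormatNames.recordK₀ F Mc k + n)).d, (Hr (⟨b.src.shift ν, b.dir⟩ : Literature.MathematicalPhysics.QuantumFieldTheory.Balaban1983to89.PBond (F.P (Summit.QuantumFields.YangMills.Theorems.K0RecordFormatNames.recordK₀ F Mc k + n)) 0) - (2 : ℂ) • Hr b + Hr (⟨b.src.unshift ν, b.dir⟩ : Literature.MathematicalPhysics.QuantumFieldTheory.Balaban1983to89.PBond (F.P (Summit.QuantumFields.YangMills.Theorems.K0RecordFormatNames.recordK₀ F Mc k + n)) 0))‖ ≤ C₉' * (F.P (Summit.QuantumFields.YangMills.Theorems.K0RecordFormatNames.recordK₀ F Mc k + n)).eta (k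 + 1) ^ 3 * Real.exp (-(δ₉ * (Literature.MathematicalPhysics.QuantumFieldTheory.Balaban1983to89.Site.tdist (Summit.QuantumFields.YangMills.Theorems.K0RecordFormatNames.coarsenTo (k + 1) b.src) y : ℝ))) ∧ ‖∑ ν : Fin (F.P (Summit.QuantumFields.YangMills.Theorems.K0RecordFormatNames.recordK₀ F Mc k + n)).d, ((Hr (⟨b.src, b.dir⟩ : Literature.MathematicalPhysics.QuantumFieldTheory.Balaban1983to89.PBond (F.P (Summit.QuantumFields.YangMills.Theorems.K0RecordFormatNames.recordK₀ F Mc k + n)) 0) + Hr (⟨(b.src).shift b.dir, ν⟩ : Literature.MathematicalPhysics.QuantumFieldTheory.Balaban1983to89.PBond (F.P (Summit.QuantumFields.YangMills.Theorems.K0RecordFormatNames.recordK₀ F Mc k + n)) 0) - Hr (⟨(b.src).shift ν, b.dir⟩ : Literature.MathematicalPhysics.QuantumFieldTheory.Balaban1983to89.PBond (F.P (Summit.QuantumFields.YangMills.Theorems.K0RecordFormatNames.recordK₀ F Mc k + n)) 0) - Hr (⟨b.src, ν⟩ : Literature.MathematicalPhysics.QuantumFieldTheory.Balaban1983to89.PBond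 (F.P (Summit.QuantumFields.YangMills.Theorems.K0RecordFormatNames.recordK₀ F Mc k + n)) 0)) - (Hr (⟨b.src.unshift ν, b.dir⟩ : Literature.MathematicalPhysics.QuantumFieldTheory.Balaban1983to89.PBond (F.P (Summit.QuantumFields.YangMills.Theorems.K0RecordFormatNames.recordK₀ F Mc k + n)) 0) + Hr (⟨(b.src.unshift ν).shift b.dir, ν⟩ : Literature.MathematicalPhysics.QuantumFieldTheory.Balaban1983to89.PBond (F.P (Summit.QuantumFields.YangMills.Theorems.K0RecordFormatNames.recordK₀ F Mc k + n)) 0) - Hr (⟨(b.src.unshift ν).shift ν, b.dir⟩ : Literature.MathematicalPhysics.QuantumFieldTheory.Balaban1983to89.PBond (F.P (Summit.QuantumFields.YangMills.Theorems.K0RecordFormatNames.recordK₀ F Mc k + n)) 0) - Hr (⟨b.src.unshift ν, ν⟩ : Literature.MathematicalPhysics.QuantumFieldTheory.Balaban1983to89.PBond (F.P (Summit.QuantumFields.YangMills.Theorems.K0RecordFormatNames.recordK₀ F Mc k + n)) 0)))‖ ≤ C₉' * (F.P (Summit.QuantumFields.YangMills.Theorems.K0RecordFormatNames.recordK₀ F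 Mc k + n)).eta (k + 1) ^ 3 * Real.exp (-(δ₉ * (Literature.MathematicalPhysics.QuantumFieldTheory.Balaban1983to89.Site.tdist (Summit.QuantumFields.YangMills.Theorems.K0RecordFormatNames.coarsenTo (k + 1) b.src) y : ℝ)))) → ∀ (ε₂₉ α₀ α₁ : ℝ), 0 < ε₂₉ → 0 < α₀ → 0 < α₁ → ∃ εn : ℝ, 0 < εn ∧ ∀ ε₀ : ℝ, 0 < ε₀ → ε₀ ≤ εn → ∀ (k n : ℕ) (B : Summit.QuantumFields.YangMills.Theorems.K0RecordFormatNames.recordW F a₀ ε₂₉ k (Summit.QuantumFields.YangMills.Theorems.K0RecordFormatNames.recordK₀ F Mc k + n)), Summit.QuantumFields.YangMills.Theorems.K0RecordFormatNames.InRegClass F Mc k ε₀ a₀ ε₂₉ n B →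
      letI θ := thetaFill F a₀ ε₂₉
      (∀ (X : (recordDomSys F Mc k (recordK₀ F Mc k + n)).Dom),
        ∀ C ∈ (Sect2.frameI (RzOfRecord F 2 (recordK₀ F Mc k + n)) Mc (k + 1) (Sect2.domSites (F.P (recordK₀ F Mc k + n)) Mc (k + 1) X)).cubes,
          ∃ u : Site (F.P (recordK₀ F Mc k + n)) 0 → (MatA 2)ˣ, (∀ x, u x ∈ (B12RegularSpaces111SpecialUnitary.suModel 2).G) ∧ ∃ A : PBond (F.P (recordK₀ F Mc k + n)) 0 → MatA 2,
            (∀ b ∈ C.bonds, B12RegularSpaces111.gaugeU u (recordBgUnits F θ k (recordK₀ F Mc k + n) B) b =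
              B12RegularSpaces111.expI (B12RegularSpaces111.StepConsts.ofParams (F.P (recordK₀ F Mc k + n)) (recordCB F) (k + 1)).ξ (A b)) ∧
            (∀ b ∈ C.bonds, ‖A b‖ < (B12RegularSpaces111.StepConsts.ofParams (F.P (recordK₀ F Mc k + n)) (recordCB F) (k + 1)).cB * α₀) ∧
            ∀ q ∈ C.dpairs, ‖B12RegularSpaces111.grad (B12RegularSpaces111.StepConsts.ofParams (F.P (recordK₀ F Mc k + n)) (recordCB F) (k + 1)).ξ q.2.1 (fun y => A ⟨y, q.2.2⟩) q.1‖ <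
              (B12RegularSpaces111.StepConsts.ofParams (F.P (recordK₀ F Mc k + n)) (recordCB F) (k + 1)).cB * α₀) ∧
      ∀ (X : (recordDomSys F Mc k (recordK₀ F Mc k + n)).Dom), ∀ b ∈ domBonds F Mc k (recordK₀ F Mc k + n) X,
        ‖recordCurrent F θ k (recordK₀ F Mc k + n) B b‖ < α₀


/-! ## §1  ★★★ `stub_regClassNestsUc` modulo the one letter -/

/-- ★★★ **THE NESTING LETTER OF RECORD FROM THE ROWS LETTER (one family)**: `RegThm1RowsAtRecord F → RegClassNestsUc F` — thread the ⁸ binders and `(ε₂₉, α₀, α₁)` into the rows letter,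
answer with the class radius `min εn α₀` (so that `ε₀ ≤ α₀`, (1.11) ≤ (1.14)'s scale), and close every class point by ✓`cutsInUc_of_inRegClass_of_localGauges`.  Bookkeeping over the
displayed letter. [cite: Balaban1987RG1, p.263 L5–13, (1.11)–(1.14) p.262; Balaban1985Variational, Thm 1 (9) p.279] -/
theorem regClassNestsUc_of_regThm1RowsAtRecord {F : T4Family} (h : RegThm1RowsAtRecord F) : RegClassNestsUc F := by
  obtain ⟨Mth, H⟩ := h
  refine ⟨Mth, fun Mc hMc j c c₀ c₁ B₃ B₃' a₀ a₁ hG h₁ h₂ h₃ h₄ h₅ h₆ h₇ hT8 hT9 hTE hP9 hP9L ε₂₉ α₀ α₁ hε hα₀ hα₁ => ?_⟩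
  obtain ⟨εn, hεn, Hn⟩ := H Mc hMc j c c₀ c₁ B₃ B₃' a₀ a₁ hG h₁ h₂ h₃ h₄ h₅ h₆ h₇ hT8 hT9 hTE hP9 hP9L ε₂₉ α₀ α₁ hε hα₀ hα₁
  refine ⟨min εn α₀, lt_min hεn hα₀, fun ε₀ hε₀ hle k n B hB => ?_⟩
  obtain ⟨hloc, hcur⟩ := Hn ε₀ hε₀ (hle.trans (min_le_left _ _)) k n B hB
  exact cutsInUc_of_inRegClass_of_localGauges F a₀ ε₂₉ Mc k n (hle.trans (min_le_right _ _)) hα₀ hα₁ hB hloc hcur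

/-- ★★★ **`stub_regClassNestsUc` MODULO THE ONE LETTER (all families)**: `(∀ F, RegThm1RowsAtRecord F) → ∀ F, RegClassNestsUc F` — v3.8's `stub_regClassNestsUc : ∀ F, RegClassNestsUc F`
is a theorem as soon as the [15]-regularity rows letter is supplied. [cite: Balaban1987RG1, p.263 L5–13; Balaban1985Variational, Thm 1 (9) p.279] -/
theorem regClassNestsUc_of_regThm1Rows (h : ∀ F, RegThm1RowsAtRecord F) : ∀ F, RegClassNestsUc F :=
  fun F => regClassNestsUc_of_regThm1RowsAtRecord (h F)

/-! ## §2  ★ (t4)-style: the rows hold at the base point `B = 0` -/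

open scoped Classical in
/-- ★ **(◆ C34 (t4)-style) THE ROWS AT THE BASE POINT ARE A THEOREM**: at `B = 0` (`U_{k+1}(W_0) = 1` in the rooted gauge, ✓`recordBgUnits_zero`; `J(1) = 0`, ✓`recordCurrent_zero`) the
(1.12) row holds on EVERY cube with `u := 1 ∈ G`, `A := 0` (`1·1·1⁻¹ = 1 = exp iξ·0`, `|0| = |∇^ξ 0| = 0 < c_B α₀` by ✓`recordCB_pos`) and the (1.14) row reads `0 < α₀`.  So the letter
`RegThm1RowsAtRecord` is consistent with the tree where both speak (a mis-keyed `c_B`, `ξ` or gauge action would fail here); `0 ∈` every class (✓`inRegClass_zero`).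
[cite: Balaban1987RG1, (1.12) p.262, (1.14) p.262, (2.3) p.265 (bookkeeping)] -/
theorem regThm1Rows_body_zero (F : T4Family) (a₀ ε₂₉ : ℝ) (Mc k n : ℕ) {α₀ : ℝ} (hα₀ : 0 < α₀) :
    letI θ := thetaFill F a₀ ε₂₉; letI := θ.instVβ₁; letI := θ.instVβ₂; letI := θ.instιβ
    (∀ (X : (recordDomSys F Mc k (recordK₀ F Mc k + n)).Dom),
      ∀ C ∈ (Sect2.frameI (RzOfRecord F 2 (recordK₀ F Mc k + n)) Mc (k + 1) (Sect2.domSites (F.P (recordK₀ F Mc k + n)) Mc (k + 1) X)).cubes,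
        ∃ u : Site (F.P (recordK₀ F Mc k + n)) 0 → (MatA 2)ˣ, (∀ x, u x ∈ (B12RegularSpaces111SpecialUnitary.suModel 2).G) ∧ ∃ A : PBond (F.P (recordK₀ F Mc k + n)) 0 → MatA 2,
          (∀ b ∈ C.bonds, B12RegularSpaces111.gaugeU u (recordBgUnits F θ k (recordK₀ F Mc k + n) (0 : recordW F a₀ ε₂₉ k (recordK₀ F Mc k + n))) b =
            B12RegularSpaces111.expI (B12RegularSpaces111.StepConsts.ofParams (F.P (recordK₀ F Mc k + n)) (recordCB F) (k + 1)).ξ (A b)) ∧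
          (∀ b ∈ C.bonds, ‖A b‖ < (B12RegularSpaces111.StepConsts.ofParams (F.P (recordK₀ F Mc k + n)) (recordCB F) (k + 1)).cB * α₀) ∧
          ∀ q ∈ C.dpairs, ‖B12RegularSpaces111.grad (B12RegularSpaces111.StepConsts.ofParams (F.P (recordK₀ F Mc k + n)) (recordCB F) (k + 1)).ξ q.2.1 (fun y => A ⟨y, q.2.2⟩) q.1‖ <
            (B12RegularSpaces111.StepConsts.ofParams (F.P (recordK₀ F Mc k + n)) (recordCB F) (k + 1)).cB * α₀) ∧
    ∀ (X : (recordDomSys F Mc k (recordK₀ F Mc k + n)).Dom), ∀ b ∈ domBonds F Mc k (recordK₀ F Mc k + n) X,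
      ‖recordCurrent F θ k (recordK₀ F Mc k + n) (0 : recordW F a₀ ε₂₉ k (recordK₀ F Mc k + n)) b‖ < α₀ := by
  letI θ := thetaFill F a₀ ε₂₉; letI := θ.instVβ₁; letI := θ.instVβ₂; letI := θ.instιβ
  have hk := succ_le_m_add_K_recordK₀ F Mc k n
  have hcB : 0 < (B12RegularSpaces111.StepConsts.ofParams (F.P (recordK₀ F Mc k + n)) (recordCB F) (k + 1)).cB * α₀ :=
    mul_pos (by simpa only [B12RegularSpaces111.StepConsts.ofParams] using PortU2.recordCB_pos F) hα₀
  refine ⟨fun X C _ => ⟨fun _ => 1, fun _ => Subgroup.one_mem _, fun _ => 0, fun b _ => ?_, fun b _ => by simpa only [norm_zero] using hcB,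
    fun q _ => ?_⟩, fun X b _ => ?_⟩
  · rw [recordBgUnits_zero F θ hk, B12RegularSpaces111Mono.expI_zero]
    simp only [B12RegularSpaces111.gaugeU, inv_one, mul_one]
  · simp only [B12RegularSpaces111.grad, sub_self, smul_zero, norm_zero]
    exact hcB
  · rw [recordCurrent_zero F θ hk, Pi.zero_apply, norm_zero]
    exact hα₀

end Summit.QuantumFields.YangMills.Theorems.BalabanUVNodesPortS1

end
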